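import Summits.ABC.IUTFork.Joshi.DictionaryUntiltsReadout
import Summits.ABC.IUTFork.Joshi.UntiltFrobeniusLine
import Summits.ABC.IUTFork.Joshi.TestUntiltsReadout
import HarnessLib

/-!
# Branch-E TEST (abc-iut-E-t1, [J-I] carrier owner): the RE-TYPED [J-I] residual is REALISED at the X-07′ instantiation — a log-faithful
# [J-I] dictionary on the Frobenius line with ALL of E-plan's located components, `S` derived through it by the E1 route (FILLS side)

Test file of the abc-iut cell, branch E (seat abc-iut-E-t1; lane (1) «[J-I] cluster vs S» of abc-iut-E-cx-3; rung LADDER-ABC:A2.E; R14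
Test* file). PROOF-ONLY over landed files imported BY NAME except for the small `def`s of the model's dictionary data (§2). TAKES NO SIDE
on [IUTchIII] Cor. 3.12, on Joshi's claims ([J-I] = K. Joshi, arXiv:2106.11452v4, bib `Joshi2021ATS1`, unrefereed) or on any report about
them; typed ≠ proved ≠ endorsed; a model EXHIBITS satisfiability of typed hypotheses, nothing more.

`S := Summit.ABC.IUTFork.Cor312Vol.PilotKummerIndRelated S P ρ qK` (Cor312PinnedRegionsThreePins.lean l.145).

THE QUESTION (abc-iut-E-cx-3, TestUntiltsReadout p436845): p431910's residual `ExponentFaithful` (LINEAR read-out of Joshi's scaling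
exponent by log-volumes) is «Y-UNSAT»: with `DatumEquivariant` it fails at BOTH models of record, so it cannot co-vary with `S`; the owner
was asked to re-type it. ANSWER (this seat): `DictionaryUntiltsReadout` (p438244) re-types the residual as `ExponentReadout` (ANY read-out
injective on the positive reals; the log read-out `ExponentLogFaithful` is the instance under which a uniform dilatation IS a constant volume
shift) and generalises p431910's location to it; `UntiltFrobeniusLine` (p438828) supplies a [J-I] points-model whose moves dilate UNIFORMLY
with an infinite-order dilating move (`×ℓ`: exponent ↦ b·exponent, the law of a Frobenius translate); THIS file is the positive side of the
test (the pinned side and the packaged contrast are `TestUntiltsFrobeniusLinePinned`).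

WHAT IS PROVED (standard axioms).
* §1 `scalRegion_tupleSet`: at abc-iut-E-t41's X-07′ operator `scalRegion` (TestIsmScalingResults p431886) the region of a tuple set
  `{(±c_j)_j}` at a label `j ∈ 𝔽_l^⋆` is the ball `B_{v_q(c_j)}`; `starAut_scaleFamily_image_tupleSet`: E-t41's (Ind2)-family `scaleFamily u`
  carries `{(±c_j)_j}` onto `{(±u_j c_j)_j}`.
* §2 THE MODEL at X-07′ (`scalFull q` / `scalSetting q` / `scalRegion q`; `Ism` = all ℚ-linear automorphisms of the packet line, (Ind2) ∋
  `x ↦ q·x`, `¬LogvolInvariant`, S TRUE — E-t41): on the Frobenius line `frobLine p q b hb` (points `ℚ^×/±1`, exponent of `[x]` = `b^{v_q(x)}`),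
  the dictionary `scalDictionary` with base `[1]`, standard point `[q] = (×q)·[1]`, datum `[x] ↦ {(± |x|^{1−j²}·q^{j²})_j}` («the theta values
  read in the holomorphic structure `[x]`») and realisation `σ ↦ scaleFamily (|σ 1|^{1−j²})_j` — so that the Frobenius-like move `×q` is
  realised by E-t41's `untiltFamily` up to sign, Joshi's untilt change `y′_{w,1} ↦ y′_{w,j}` ([J-III] Thm 4.2.2.1 (4)). VERDICTS, each a
  theorem: `baseIsThetaPilot_scal`, `movesAreInd_scal`, `datumEquivariant_scal`, `std_mem_ptOrbit_scal` / `stdReachable_scal`,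
  `standardPointIsQPilot_scal`, **`exponentLogFaithful_scal`** (at the label `2`: `logvol = (3·log q / log b)·log(exponent) − 4·log q`),
  `frobLine_actionDilates` (p438828), and **`scal_pilotKummerIndRelated_of_frobLine`: S DERIVED THROUGH THE E1 ROUTE** (E-t1 p430512
  `pilotKummerIndRelated_of_orbit`) from the [J-I] dictionary — not merely co-present; `not_exponentFaithful_scal`: the LINEAR read-out is
  false for the same data (E-cx-3's theorem BY NAME); `frobLine_scal_fills` packages the side with E-t41's `scalSetting_not_logvolInvariant`
  (the located hypothesis of the [J-I] location indeed FAILS here).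
READING for the test ledger (R9/R13, neutral; both sides in the companion file): «E TEST J1-cluster (re-typed read-out): target=S — FILLS at
X-07′ | J-FALSE-AT-PINNED (every faithful read-out) | residual BY NAME `MRData.LogvolInvariant`: the [J-I] cluster reaches `S` exactly where
(Ind2) contains the valuation-rescaling `x ↦ q·x` (X-07′'s located sentence, now reached from the [J-I] side with a Frobenius-like dilating
move and a faithful volume read-out), and there `Statement` fails as typed (E-t41 `scalSetting_not_statement_not_bridgeHyps`)». Located,
not adjudicated. [claim: Joshi2021ATS1, status: disputed]; our side [claim: Mochizuki2012, status: disputed].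
-/

noncomputable section

open Set

namespace Summit.ABC.IUTFork.Joshi

open Summit.ABC.IUTFork.Thm311 Summit.ABC.IUTFork.Cor312 Summit.ABC.IUTFork.Cor312Vol
open Cor312.Checks Cor312.IdentifiedNonVacuity NaiveWitness PinnedWitness IsmScaling

/-! ## 1. Tuple sets `{(±c_j)_j}`: their regions at the X-07′ operator and their transport under `scaleFamily` -/

namespace FrobLine

/-- The tuple set `{(±c_j)_{j ∈ 𝔽_l^⋆}}` of the star packet at `v` (the shape of the splitting monoid `Ψ_v = {(±q^{j²})_j}` and of the
q-pilot datum `{(±q)_j}` of the models of record). [folklore] -/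
def tupleSet (v : toyIndex.V) (c : toyIndex.LabelStar → ℚ) : Set (signShells.StarPacket v) :=
  {f | ∀ j : toyIndex.LabelStar, line j.1 (toyIndex.over v) (f j) = c j ∨ line j.1 (toyIndex.over v) (f j) = -c j}

variable (q : ℕ) [hq : Fact q.Prime]

/-- **The X-07′ region of a tuple set is a ball**: `scalRegion {(±c_j)_j} = c_j·𝒪 = B_{v_q(c_j)}` at `j ∈ 𝔽_l^⋆`. [folklore] -/
theorem scalRegion_tupleSet {j : toyIndex.Label} (hj : j ≠ 0) (vQ : toyIndex.VQ) (c : toyIndex.LabelStar → ℚ)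
    (hc : c ⟨j, hj⟩ ≠ 0) :
    scalRegion q (fun v _ => tupleSet v c) j vQ = pBall q j vQ (padicValRat q (c ⟨j, hj⟩)) := by
  unfold scalRegion
  rw [dif_neg hj]
  ext x
  constructor
  · rintro ⟨ψ, hψ, u, hu, hx⟩
    have hψj : line j vQ (ψ ⟨j, hj⟩) = c ⟨j, hj⟩ ∨ line j vQ (ψ ⟨j, hj⟩) = -c ⟨j, hj⟩ := hψ ⟨j, hj⟩
    have hu' : line j vQ u = 0 ∨ (0 : ℤ) ≤ padicValRat q (line j vQ u) := hu
    show line j vQ x = 0 ∨ padicValRat q (c ⟨j, hj⟩) ≤ padicValRat q (line j vQ x)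
    by_cases hx0 : line j vQ x = 0
    · exact Or.inl hx0
    · right
      have hune : line j vQ u ≠ 0 := fun h => hx0 (by rw [hx, h, mul_zero])
      have hψne : line j vQ (ψ ⟨j, hj⟩) ≠ 0 := by
        rcases hψj with h | h
        · rw [h]; exact hc
        · rw [h]; exact neg_ne_zero.2 hc
      have hval : padicValRat q (line j vQ (ψ ⟨j, hj⟩)) = padicValRat q (c ⟨j, hj⟩) := by
        rcases hψj with h | h
        · rw [h]
        · rw [h, padicValRat.neg]
      rcases hu' with h0 | h0
      · exact absurd h0 hune
      · rw [hx, padicValRat.mul hψne hune, hval]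
        linarith
  · intro hx
    have hx' : line j vQ x = 0 ∨ padicValRat q (c ⟨j, hj⟩) ≤ padicValRat q (line j vQ x) := hx
    refine ⟨fun i => (line i.1 vQ).symm (c i), fun i => Or.inl (LinearEquiv.apply_symm_apply _ _),
      (line j vQ).symm (line j vQ x / c ⟨j, hj⟩), ?_, ?_⟩
    · show line j vQ ((line j vQ).symm (line j vQ x / c ⟨j, hj⟩)) = 0 ∨
        (0 : ℤ) ≤ padicValRat q (line j vQ ((line j vQ).symm (line j vQ x / c ⟨j, hj⟩)))
      rw [LinearEquiv.apply_symm_apply]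
      by_cases hx0 : line j vQ x = 0
      · left; rw [hx0, zero_div]
      · right
        rcases hx' with h0 | h0
        · exact absurd h0 hx0
        · rw [padicValRat.div hx0 hc]
          linarith
    · rw [LinearEquiv.apply_symm_apply, LinearEquiv.apply_symm_apply, mul_div_cancel₀ _ hc]

omit hq in
/-- **E-t41's (Ind2)-family `scaleFamily u` carries `{(±c_j)_j}` onto `{(±u_j·c_j)_j}`** (it is multiplication by `u_j` on the label-`j`
packet line, `line_scaleFamily`). [folklore] -/
theorem starAut_scaleFamily_image_tupleSet (u : toyIndex.Label → ℚˣ) (v : toyIndex.V) (c : toyIndex.LabelStar → ℚ) :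
    scalShells.starAut (scaleFamily u) v '' tupleSet v c = tupleSet v (fun j => (u j.1 : ℚ) * c j) := by
  ext f'
  constructor
  · rintro ⟨f, hf, rfl⟩ j
    show line j.1 (toyIndex.over v) (scaleFamily u j.1 (toyIndex.over v) (f j)) = (u j.1 : ℚ) * c j ∨
      line j.1 (toyIndex.over v) (scaleFamily u j.1 (toyIndex.over v) (f j)) = -((u j.1 : ℚ) * c j)
    rw [line_scaleFamily]
    rcases hf j with h | h
    · left; rw [h]
    · right; rw [h, mul_neg]
  · intro hf'
    refine ⟨fun j => (line j.1 (toyIndex.over v)).symm (line j.1 (toyIndex.over v) (f' j) / u j.1), fun j => ?_, ?_⟩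
    · rw [LinearEquiv.apply_symm_apply]
      rcases hf' j with h | h
      · left; rw [h, mul_div_cancel_left₀ _ (u j.1).ne_zero]
      · right; rw [h, neg_div, mul_div_cancel_left₀ _ (u j.1).ne_zero]
    · funext j
      apply (line j.1 (toyIndex.over v)).injective
      show line j.1 (toyIndex.over v) (scaleFamily u j.1 (toyIndex.over v)
          ((line j.1 (toyIndex.over v)).symm (line j.1 (toyIndex.over v) (f' j) / u j.1))) = line j.1 (toyIndex.over v) (f' j)
      rw [line_scaleFamily, LinearEquiv.apply_symm_apply, mul_div_cancel₀ _ (u j.1).ne_zero]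

/-! ## 2. The log-faithful [J-I] dictionary on the Frobenius line, at the X-07′ instantiation -/

/-- **The theta values read in the holomorphic structure `[x]`**: the coefficient tuple `(|x|^{1−j²}·q^{j²})_{j ∈ 𝔽_l^⋆}` — at `x = ±1` the
theta values `(q^{j²})_j`, at `x = ±q` the q-pilot values `(q)_j`; in general Joshi's untilt change read multiplicatively («`v_{K_j}(p) =
j²·v_{K_1}(p)`», [J-IIp] Thm 6.9.1; E-t41's `untiltFamily`: `p^{1−j²}` on the label-`j` line). [folklore] -/
def coef (a : ℚ) (j : toyIndex.LabelStar) : ℚ := |a| ^ (1 - jsq j.1) * (q : ℚ) ^ ((j.1 : ℕ) ^ 2)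

/-- The coefficients are nonzero for `x ≠ 0`. [folklore] -/
theorem coef_ne_zero {a : ℚ} (ha : a ≠ 0) (j : toyIndex.LabelStar) : coef q a j ≠ 0 :=
  mul_ne_zero (zpow_ne_zero _ (abs_ne_zero.2 ha)) (pow_ne_zero _ (Nat.cast_ne_zero.2 hq.out.ne_zero))

omit hq in
/-- They only depend on the point `[x] = {±x}`. [folklore] -/
theorem coef_neg (a : ℚ) (j : toyIndex.LabelStar) : coef q (-a) j = coef q a j := by
  unfold coef; rw [abs_neg]

omit hq in
/-- At `x = 1`: the theta values `q^{j²}`. [folklore] -/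
theorem coef_one (j : toyIndex.LabelStar) : coef q 1 j = (q : ℚ) ^ ((j.1 : ℕ) ^ 2) := by
  unfold coef; rw [abs_one, one_zpow, one_mul]

omit hq in
/-- Multiplicativity in the point: `coef (c·x)_j = |c|^{1−j²} · coef (x)_j`. [folklore] -/
theorem coef_mul (c a : ℚ) (j : toyIndex.LabelStar) : coef q (c * a) j = |c| ^ (1 - jsq j.1) * coef q a j := by
  unfold coef; rw [abs_mul, mul_zpow, mul_assoc]

omit hq in
/-- … in particular along a move `σ` of the Frobenius line (`σ x = σ1·x`): `coef (σ x)_j = |σ 1|^{1−j²} · coef (x)_j`. [folklore] -/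
theorem coef_linearEquiv (σ : ℚ ≃ₗ[ℤ] ℚ) (a : ℚ) (j : toyIndex.LabelStar) :
    coef q (σ a) j = |σ 1| ^ (1 - jsq j.1) * coef q a j := by
  rw [linearEquiv_apply, coef_mul]

/-- At `x = q`: the q-pilot values `q^{1−j²}·q^{j²} = q`. [folklore] -/
theorem coef_q (j : toyIndex.LabelStar) : coef q q j = q := by
  have hq0 : (q : ℚ) ≠ 0 := Nat.cast_ne_zero.2 hq.out.ne_zero
  unfold coef
  rw [Nat.abs_cast, ← zpow_natCast, ← zpow_add₀ hq0]
  have h : (1 - jsq j.1 + (((j.1 : ℕ) ^ 2 : ℕ) : ℤ)) = 1 := by unfold jsq; ring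
  rw [h, zpow_one]

/-- The valuation of the coefficient: `v_q(coef (x)_j) = (1 − j²)·v_q(x) + j²`. [folklore] -/
theorem padicValRat_coef {a : ℚ} (ha : a ≠ 0) (j : toyIndex.LabelStar) :
    padicValRat q (coef q a j) = (1 - jsq j.1) * padicValRat q a + jsq j.1 := by
  have hq0 : (q : ℚ) ≠ 0 := Nat.cast_ne_zero.2 hq.out.ne_zero
  have habs : padicValRat q |a| = padicValRat q a := by
    rcases abs_choice a with h | h
    · rw [h]
    · rw [h, padicValRat.neg]
  unfold coef
  rw [padicValRat.mul (zpow_ne_zero _ (abs_ne_zero.2 ha)) (pow_ne_zero _ hq0), padicValRat.zpow, habs, padicValRat.pow,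
    padicValRat.self hq.out.one_lt, mul_one]
  unfold jsq
  push_cast
  ring

/-- **The datum of the dictionary**: `[x] ↦ {(± coef (x)_j)_j}` at every bad place (well defined on `ℚ^×/±1`). [folklore] -/
def scalDatum : ProjPoints ℤ ℚ → ∀ v : toyIndex.V, v ∈ toyIndex.Vbad → Set (signShells.StarPacket v) :=
  Quotient.lift (fun (g : {g : ℚ // g ≠ 0}) (v : toyIndex.V) (_ : v ∈ toyIndex.Vbad) => tupleSet v (coef q (g : ℚ)))
    fun g h hgh => by
      obtain ⟨u, hu⟩ := hgh
      funext v hv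
      show tupleSet v (coef q (g : ℚ)) = tupleSet v (coef q (h : ℚ))
      rw [← hu]
      rcases Int.units_eq_one_or u with rfl | rfl
      · rw [one_smul]
      · rw [Units.smul_def, Units.val_neg, Units.val_one, neg_smul, one_smul,
          show coef q (-(g : ℚ)) = coef q (g : ℚ) from funext fun j => coef_neg q (g : ℚ) j]

omit hq in
/-- Unfolding on representatives. [folklore] -/
theorem scalDatum_mk (g : {g : ℚ // g ≠ 0}) :
    scalDatum q (Quotient.mk (unitRel ℤ ℚ) g) = fun v _ => tupleSet v (coef q (g : ℚ)) := rfl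

/-- **The realisation of a move**: `σ ↦ scaleFamily (|σ 1|^{1−j²})_j` — multiplication by `|σ 1|^{1−j²}` on the label-`j` packet line, an
element of `⟨(Ind1) ∪ (Ind2)⟩` of the Joshi-style shells (E-t41 `scaleFamily_mem_closure`); for the Frobenius-like move `×q` this is
`q^{1−j²}`, E-t41's `untiltFamily`. [folklore] -/
def scalMult (σ : ℚ ≃ₗ[ℤ] ℚ) : toyIndex.Label → ℚˣ := fun j =>
  Units.mk0 (|σ 1| ^ (1 - jsq j)) (zpow_ne_zero _ (abs_ne_zero.2 (linearEquiv_one_ne_zero σ)))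

omit hq in
/-- The multiplier at the label `j`. [folklore] -/
theorem coe_scalMult (σ : ℚ ≃ₗ[ℤ] ℚ) (j : toyIndex.Label) : (scalMult σ j : ℚ) = |σ 1| ^ (1 - jsq j) := rfl

variable (p : ℕ) [Fact p.Prime] (b : ℝ) (hb : 0 < b)

/-- The realisation map of the dictionary. [folklore] -/
def scalReal (σ : (frobLine p q b hb).Aut) : scalShells.PacketAut := scaleFamily (scalMult (σ.toLinearEquiv : ℚ ≃ₗ[ℤ] ℚ))

/-- The base point `[1]` (the holomorphic structure carrying the line's Θ-pilot datum). [folklore] -/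
def basePt : (frobLine p q b hb).Pt := pt 1 one_ne_zero

/-- The standard point `[q] = (×q)·[1]`. [folklore] -/
def stdPt : (frobLine p q b hb).Pt :=
  (frobLine p q b hb).ptAct (mulAut b hb (q : ℚ) (Nat.cast_ne_zero.2 hq.out.ne_zero)) (basePt q p b hb)

/-- **THE LOG-FAITHFUL [J-I] DICTIONARY on the Frobenius line at X-07′** (E-plan's `Joshi.Dictionary` through E-t1's `toDictionary`).
[claim: Joshi2021ATS1, status: disputed] -/
def scalDictionary : Dictionary (scalFull q).toLatticeSituation :=
  (frobLine p q b hb).toDictionary (scalFull q).toLatticeSituation (basePt q p b hb) (stdPt q p b hb) (scalDatum q) (scalReal q p b hb)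

/-- **`MovesAreInd` HOLDS**: every move is realised inside `⟨(Ind1) ∪ (Ind2)⟩` of the Joshi-style shells. [claim: Joshi2021ATS1, status: disputed] -/
theorem movesAreInd_scal : MovesAreInd (scalDictionary q p b hb) := fun _ => scaleFamily_mem_closure _

/-- **`DatumEquivariant` HOLDS**: reading the theta values in the moved structure `σ·[x] = [σ1·x]` IS transporting them by the realisation
(`coef (σ1·x)_j = |σ1|^{1−j²}·coef (x)_j`). [claim: Joshi2021ATS1, status: disputed] -/
theorem datumEquivariant_scal : DatumEquivariant (scalDictionary q p b hb) := by
  rw [scalDictionary, UntiltPoints.datumEquivariant_toDictionary_iff]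
  intro σ y v hv
  induction y using Quotient.inductionOn with
  | h g =>
    show tupleSet v (coef q ((σ.toLinearEquiv : ℚ ≃ₗ[ℤ] ℚ) (g : ℚ))) =
      scalShells.starAut (scaleFamily (scalMult (σ.toLinearEquiv : ℚ ≃ₗ[ℤ] ℚ))) v '' tupleSet v (coef q (g : ℚ))
    rw [starAut_scaleFamily_image_tupleSet]
    congr 1
    funext j
    exact coef_linearEquiv q (σ.toLinearEquiv : ℚ ≃ₗ[ℤ] ℚ) (g : ℚ) j

/-- **`BaseIsThetaPilot` HOLDS**: at `[1]` the datum is the line's splitting monoid `Ψ_v = {(±q^{j²})_j}`. [claim: Joshi2021ATS1, status: disputed] -/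
theorem baseIsThetaPilot_scal : BaseIsThetaPilot (scalDictionary q p b hb) (P := scalSetting q) := by
  show scalDatum q (pt 1 one_ne_zero) = fun v _ => Psi q v
  funext v hv
  show tupleSet v (coef q 1) = Psi q v
  exact Set.ext fun f => forall_congr' fun j => by rw [coef_one]

/-- The standard point lies in the orbit of the base point (by construction: `[q] = (×q)·[1]`). [folklore] -/
theorem std_mem_ptOrbit_scal : stdPt q p b hb ∈ (frobLine p q b hb).ptOrbit (basePt q p b hb) := ⟨_, rfl⟩

/-- **`StdReachable` HOLDS.** [claim: Joshi2021ATS1, status: disputed] -/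
theorem stdReachable_scal : StdReachable (scalDictionary q p b hb) :=
  UntiltPoints.stdReachable_iff_mem_ptOrbit.2 (std_mem_ptOrbit_scal q p b hb)

/-- The regions of the data are balls at `j ∈ 𝔽_l^⋆` (and the convention `univ` at `0`): ADMISSIBLE for the X-07′ data. [folklore] -/
theorem adm_scalRegion_scalDatum (y : (frobLine p q b hb).Pt) (j : toyIndex.Label) (vQ : toyIndex.VQ) :
    ((scalFull q).toLatticeSituation.D (scalSetting q).n).Adm j vQ (scalRegion q (scalDatum q y) j vQ) := by
  induction y using Quotient.inductionOn with
  | h g =>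
    by_cases hj : j = 0
    · subst hj
      exact Or.inl ⟨rfl, scalRegion_zero q _ vQ⟩
    · exact Or.inr ⟨_, scalRegion_tupleSet q hj vQ _ (coef_ne_zero q g.2 _)⟩

/-- The region of the datum of `[x]` at `j ∈ 𝔽_l^⋆` is the ball `B_{(1−j²)·v_q(x) + j²}`. [folklore] -/
theorem scalRegion_scalDatum_mk {j : toyIndex.Label} (hj : j ≠ 0) (vQ : toyIndex.VQ) (g : {g : ℚ // g ≠ 0}) :
    scalRegion q (scalDatum q (Quotient.mk (unitRel ℤ ℚ) g)) j vQ =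
      pBall q j vQ ((1 - jsq j) * padicValRat q (g : ℚ) + jsq j) := by
  rw [scalDatum_mk, scalRegion_tupleSet q hj vQ _ (coef_ne_zero q g.2 _), padicValRat_coef q g.2]

/-- **`StandardPointIsQPilot` HOLDS** (region form): at `[q]` the datum is `{(±q)_j}`, whose region `B_1 = q·𝒪` is the region of the
q-pilot's Kummer datum at every label (E-t41 `scalRegion_qDatum`). [claim: Joshi2021ATS1, status: disputed] -/
theorem standardPointIsQPilot_scal : StandardPointIsQPilot (scalRegion q) (qDatum q) (scalDictionary q p b hb) := by
  intro j vQ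
  by_cases hj : j = 0
  · subst hj
    show scalRegion q (scalDatum q (stdPt q p b hb)) 0 vQ = scalRegion q (qDatum q) 0 vQ
    rw [scalRegion_zero, scalRegion_zero]
  · show scalRegion q (fun v _ => tupleSet v (coef q ((q : ℚ) * 1))) j vQ = scalRegion q (qDatum q) j vQ
    rw [mul_one, scalRegion_qDatum q hj, scalRegion_tupleSet q hj vQ _ (coef_ne_zero q (Nat.cast_ne_zero.2 hq.out.ne_zero) _),
      coef_q, padicValRat.self hq.out.one_lt]

include p hb in
/-- **S DERIVED THROUGH THE E1 ROUTE at X-07′**: `PilotKummerIndRelated` for E-t41's Joshi-style instantiation FOLLOWS from the [J-I]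
dictionary on the Frobenius line by E-t1's p430512 `pilotKummerIndRelated_of_orbit` (BaseIsThetaPilot, MovesAreInd, DatumEquivariant,
std ∈ orbit, StandardPointIsQPilot — all theorems above). «S follows from the typed [J-I] construction AT THIS INSTANTIATION» — where (Ind2)
contains `x ↦ q·x` and `Statement` fails as typed (E-t41). [claim: Mochizuki2012, status: disputed] -/
theorem scal_pilotKummerIndRelated_of_frobLine :
    PilotKummerIndRelated (scalFull q).toLatticeSituation (scalSetting q) (scalRegion q) (qDatum q) :=
  UntiltPoints.pilotKummerIndRelated_of_orbit (scalRegion q) (qDatum q) (baseIsThetaPilot_scal q p b hb)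
    (movesAreInd_scal q p b hb) (datumEquivariant_scal q p b hb) (std_mem_ptOrbit_scal q p b hb)
    (standardPointIsQPilot_scal q p b hb)

/-- The label `2 ∈ 𝔽_l^⋆` of the toy index (`l⋆ = 2`). [folklore] -/
def labTwo : toyIndex.Label := ⟨2, by show 2 < toyIndex.lstar + 1; decide⟩

omit hq in
/-- `labTwo ≠ 0`. [folklore] -/
theorem labTwo_ne_zero : labTwo ≠ 0 := by decide

omit hq in
/-- `j² = 4` at the label `2`. [folklore] -/
theorem jsq_labTwo : jsq labTwo = 4 := by decide

/-- **`ExponentLogFaithful` HOLDS**: at the label `2` the read log-volume of the datum of `y` is `(3·log q/log b)·log(exponent y) − 4·log q`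
(region `B_{4 − 3·v_q(x)}`, log-volume `(3·v_q(x) − 4)·log q`, exponent `b^{v_q(x)}`) — a NON-ZERO multiple of the log of Joshi's scaling
exponent: the log-volumes SEE the deformation parameter. [claim: Joshi2021ATS1, status: disputed] -/
theorem exponentLogFaithful_scal (hb1 : b ≠ 1) :
    UntiltPoints.ExponentLogFaithful (frobLine p q b hb) (scalFull q).toLatticeSituation (scalSetting q).n (scalRegion q) (scalDatum q) := by
  have hlogq : 0 < Real.log q := Real.log_pos (by exact_mod_cast hq.out.one_lt)
  have hlogb : Real.log b ≠ 0 := Real.log_ne_zero_of_pos_of_ne_one hb hb1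
  refine ⟨labTwo, (), 3 * Real.log q / Real.log b, -4 * Real.log q,
    div_ne_zero (mul_ne_zero three_ne_zero hlogq.ne') hlogb, fun y => ?_⟩
  induction y using Quotient.inductionOn with
  | h g =>
    show pVol q labTwo () (scalRegion q (scalDatum q (Quotient.mk (unitRel ℤ ℚ) g)) labTwo ()) = _
    rw [scalRegion_scalDatum_mk q labTwo_ne_zero, pVol_pBall, exponent_frobLine, idx_mk, jsq_labTwo, Real.log_zpow]
    push_cast
    field_simp
    ring

/-- … whereas the LINEAR read-out `ExponentFaithful` is FALSE for the same data (abc-iut-E-cx-3's `scal_not_datumEquivariant_and_exponentFaithful`,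
TestUntiltsReadout p436845, BY NAME, with `datumEquivariant_scal`). [claim: Joshi2021ATS1, status: disputed] -/
theorem not_exponentFaithful_scal (hb1 : b ≠ 1) :
    ¬ UntiltPoints.ExponentFaithful (frobLine p q b hb) (scalFull q).toLatticeSituation (scalSetting q).n (scalRegion q) (scalDatum q) :=
  fun hX => scal_not_datumEquivariant_and_exponentFaithful (frobLine p q b hb) q (base := basePt q p b hb) (std := stdPt q p b hb)
    (scalDatum q) (scalReal q p b hb) (frobLine_actionDilates b hb hb1) (adm_scalRegion_scalDatum q p b hb)
    ⟨datumEquivariant_scal q p b hb, hX⟩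

/-- **FILLS at X-07′ — the packaged positive side.** On a [J-I] points-signature whose action DILATES, the dictionary satisfies ALL of
E-plan's located components AND the re-typed faithful read-out, and `S` holds (derived by the E1 route); the located hypothesis of the
[J-I] location, `MRData.LogvolInvariant`, FAILS here (E-t41 `scalSetting_not_logvolInvariant`). [claim: Joshi2021ATS1, status: disputed] -/
theorem frobLine_scal_fills (hb1 : b ≠ 1) :
    (frobLine p q b hb).ActionDilates ∧
      BaseIsThetaPilot (scalDictionary q p b hb) (P := scalSetting q) ∧ MovesAreInd (scalDictionary q p b hb) ∧
      DatumEquivariant (scalDictionary q p b hb) ∧ StdReachable (scalDictionary q p b hb) ∧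
      StandardPointIsQPilot (scalRegion q) (qDatum q) (scalDictionary q p b hb) ∧
      UntiltPoints.ExponentLogFaithful (frobLine p q b hb) (scalFull q).toLatticeSituation (scalSetting q).n (scalRegion q)
        (scalDatum q) ∧
      PilotKummerIndRelated (scalFull q).toLatticeSituation (scalSetting q) (scalRegion q) (qDatum q) ∧
      ¬ ((scalFull q).D (scalSetting q).n).LogvolInvariant :=
  ⟨frobLine_actionDilates b hb hb1, baseIsThetaPilot_scal q p b hb, movesAreInd_scal q p b hb, datumEquivariant_scal q p b hb,
    stdReachable_scal q p b hb, standardPointIsQPilot_scal q p b hb, exponentLogFaithful_scal q p b hb hb1,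
    scal_pilotKummerIndRelated_of_frobLine q p b hb, scalSetting_not_logvolInvariant q⟩

end FrobLine

end Summit.ABC.IUTFork.Joshi

end
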